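import Literature.AlgebraicGeometry.HodgeTheory.WeilClassesCyclicPrymTyping
import Literature.AlgebraicGeometry.HodgeTheory.WeilClassesFourfoldsProofs
import Literature.AlgebraicGeometry.HodgeTheory.WeilClassesProducts
import Literature.AlgebraicGeometry.HodgeTheory.AbelianVarietyPullbackAlgebraicClasses
import Literature.AlgebraicGeometry.HodgeTheory.HodgeClassOfMorphismProofs
import Literature.AlgebraicGeometry.HodgeTheory.ComplexGysinHodgeType
import Literature.AlgebraicGeometry.HodgeTheory.CanonicalTrace
import HarnessLib

/-!
# Ring 2 · sub-cell AbelianAll (ALL ABELIAN VARIETIES), André axis, part XLVIII-a — CONJUGATE WEIL LINES AND THE TWISTED PRODUCT: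
# `E₋(A, φ) = E₊(A, −φ)` on the carriers, and `E₊(A₁) ⊠ E₋(A₂) ⊆ E₊(A₁ × A₂, φ₁ × (−φ₂))` — the MIXED exterior products of Weil
# classes of two Weil-type abelian varieties are the Weil classes of the product for the conjugate-twisted `K`-action

HONEST FRAMING (page 1, verbatim): **research route, not a corollary; conditional on HC_CM plus one named
minimal statement.** Cell line: research route conditional on HC_CM; not a corollary; Q11.4-sentence-2
already refuted in dim ≥ 3. Nothing in this file proves a case of the Hodge conjecture or of `B(X)` for a named `X`: it is carrier-level
linear algebra on the tree's Weil eigenclasses (`HodgeTheory/WeilClasses`, van Geemen 4.9). `HC_CM`, `HC_AV`, Verdier and the nodes do NOT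
occur. Item `Theses.RankFourFaces.CMToAbelian` (stmt-16267) stays OPEN; N104 untouched; no node is born (0 `def`, 0 `sorry`, no named fact).
Seat `pub-hodge-ring2-ab-andre-2`, gen 40 (part XLVIII: the transport classes of the André axis are Weil classes of conjugate-twisted products).

## Content (theorems only; standard axioms; fact-free)

* §1 **`weilClassesMinus_eq_weilClassesPlus_neg`**, **`weilClassesPlus_eq_weilClassesMinus_neg`**, **`weilClassesOf_neg`** — for `φ ≫ φ = −d`,
  `d ≥ 1`: `E₋(A, φ) = E₊(A, −φ)`, `E₊(A, φ) = E₋(A, −φ)`, and the Weil PLANE of `(A, −φ)` is that of `(A, φ)`. On the carriers the eigen-conditions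
  are only asked of the test endomorphisms `x·𝟙 + y·φ` with `x, y ∈ ℕ` (the semiring `ℕ[φ]`), so this is NOT definitional: the proof is the identity
  `(x𝟙 + yφ)(x𝟙 − yφ) = (x² + dy²)·𝟙` in `End(A)` and `(x + iy√d)(x − iy√d) = x² + dy²` (`ker`-free division by `(x − iy√d)^{2n} ≠ 0`).
  In print: `(A, −φ)` is `(A, K)` with the conjugate embedding `K ↪ End⁰(A)`; its Weil lines are the same two lines, swapped.
* §2 **`cupProduct_map_fst_map_snd_ne_zero_of_ne_zero`** — `pr_1^* a ∪ pr_2^* b ≠ 0` for `a ≠ 0`, `b ≠ 0` in ANY degrees on smooth projective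
  `Y × X` (the correspondence `[pr_1^* a ∪ pr_2^* b]_*` is `u ↦ ±λ⟨u, b⟩ a`, Voisin I (11.11), non-zero by Poincaré duality on `X`).
* §3 THE TWISTED PRODUCT. For abelian varieties `A₁`, `A₂` with `φᵢ ≫ φᵢ = −d` and an endomorphism `Φ` of `A₁ × A₂` with `Φ ≫ pr₁ = pr₁ ≫ φ₁`,
  `Φ ≫ pr₂ = pr₂ ≫ (−φ₂)` (e.g. the display notation `twistedProd[φ₁, φ₂] = φ₁ × (−φ₂)`, spelled `prodLift (fst ≫ φ₁) (snd ≫ (−φ₂))`, no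
  definition; `Φ ≫ Φ = −d`, **`twistedProd_comp_self_eq_neg_nsmul`**): **`cupProduct_map_fst_map_snd_mem_weilClassesPlus_of_plus_of_minus`** `E₊(A₁) ⊠ E₋(A₂) ⊆ E₊(A₁ × A₂, Φ)`,
  **`…_mem_weilClassesMinus_of_minus_of_plus`** `E₋(A₁) ⊠ E₊(A₂) ⊆ E₋(A₁ × A₂, Φ)`, **`mixedWeilComponent_mem_weilClassesOf`**: the MIXED component
  `pr₁^*u₊ ∪ pr₂^*v₋ + pr₁^*u₋ ∪ pr₂^*v₊` of the exterior product of two Weil classes lies in the Weil plane of the twisted product — the two terms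
  that `HodgeTheory/WeilClassesProducts` records as lying OUTSIDE the Weil plane of the untwisted product `φ₁ × φ₂`.
* §4 ALGEBRAICITY BOOKKEEPING on a Weil-type `(B, ψ)` (`dim B = 2n`, `ψ ≫ ψ = −d`, `n, d ≥ 1`): **`mem_algebraicClasses_of_add_mem_algebraicClasses`** —
  if `c₊ ∈ E₊`, `c₋ ∈ E₋` and `c₊ + c₋` is algebraic then `c₊` and `c₋` are algebraic (pull back by one test endomorphism separating the two characters;
  pull-back along an endomorphism of an abelian variety preserves algebraic classes, the tree's PROVED `map_mem_algebraicClasses_of_abelianVariety`);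
  **`weilClassesOf_le_algebraicClasses_of_add_mem`** — if moreover `c₊ ≠ 0` then the whole Weil plane of `(B, ψ)` consists of algebraic classes
  (`E±` are LINES: the tree's `finrank_weilClassesPlus_eq_one` with `H•(B(ℂ)) = ⋀•H¹`, `b₁ = 4n`, both PROVED in the tree —
  `AbelianVariety.hasExteriorCohomologyH1_complexPoints`, `AbelianVariety.finrank_complexBetti_one`); applied to the twisted product:
  **`weilClassesOf_twistedProd_le_algebraicClasses_of_mixed_mem`** — ONE algebraic mixed class `pr₁^*u₊ ∪ pr₂^*v₋ + pr₁^*u₋ ∪ pr₂^*v₊` with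
  `u₊ ≠ 0 ≠ v₋` makes the Weil plane of `(A₁ × A₂, φ₁ × (−φ₂))` algebraic; and conversely **`mixed_mem_algebraicClasses_of_weilClassesOf_le`**.

## Honest status / print dictionary (NOT formalised: no Hermitian form on the carriers)

For `(Aᵢ, K, Eᵢ)` polarised of Weil type (dim `2nᵢ`, discriminants `δᵢ ∈ ℚ^×/N(K^×)` [vanGeemen1994HodgeAV, Lemma 5.2 (3)]) the twisted product
`(A₁ × A₂, φ₁ × (−φ₂)) = A₁ × Ā₂` is of Weil type with discriminant `δ₁ δ̄₂ = δ₁ δ₂`; for two members `X_s`, `X_t` of ONE connected family of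
polarised Weil-type `2n`-folds `δ_s = δ_t` and `disc(X_s × X̄_t) = δ² ∈ N(K^×)` is TRIVIAL — the twisted products of two members of a Weil-type pencil
are of SPLIT (hyperbolic) type (Landherr); this is where part XLVIII-c's transport classes live. No case of HC is proved; nothing minimal is claimed;
N104 untouched. EDGE LABELS: all K (no binder). References: vanGeemen1994HodgeAV (4.9, Lemma 5.2, Thm. 6.12); Schoen1998HodgeWeilAddendum (§10);
Markman2025SurveySecant (§11.5); VoisinHodgeI2002 (Lemma 11.41); Fulton1998 (Cor. 19.2 (b)); Deligne1982HodgeCycles (§4); Schoen1988HodgeWeil (Lemma 1.2).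
-/

noncomputable section

set_option linter.dupNamespace false

namespace Summit.HodgeConjecture.HodgeConjecture.Ring2.AbelianAll

open CategoryTheory CategoryTheory.Limits AlgebraicGeometry MonoidalCategory CartesianMonoidalCategory
open Literature.AlgebraicGeometry Literature.AlgebraicGeometry.Motives
open Literature.AlgebraicGeometry.HodgeTheory
open Literature.AlgebraicTopology.SingularHomology (singularCohomology cupProduct cupProduct_map cupPairing cupPairing_apply
  cupProduct_gradedComm_holds)

/-! ## §1 Conjugate Weil lines: `E₋(A, φ) = E₊(A, −φ)` -/

section Conjugate

variable {A : Motives.AbelianVariety ℂ}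

/-- `(−φ)² = −d` whenever `φ² = −d`: the conjugate `K`-structure is a `K`-structure. [cite: vanGeemen1994HodgeAV, 5.2] -/
theorem neg_comp_neg_eq_neg_nsmul {d : ℕ} {φ : A ⟶ A} (hφ : φ ≫ φ = -(d • 𝟙 A)) : (-φ) ≫ (-φ) = -(d • 𝟙 A) := by
  rw [Preadditive.neg_comp, Preadditive.comp_neg, neg_neg, hφ]

/-- **`(x𝟙 + yφ) ≫ (x𝟙 − yφ) = (x² + y²d)·𝟙`** in `End(A)` for `φ² = −d` (written with a vanishing `φ`-coefficient, the shape of the test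
endomorphisms of `HodgeTheory/WeilClasses`). [cite: vanGeemen1994HodgeAV, 4.8–4.9] -/
theorem nsmul_id_add_nsmul_comp_nsmul_id_add_nsmul_neg {d : ℕ} {φ : A ⟶ A} (hφ : φ ≫ φ = -(d • 𝟙 A)) (x y : ℕ) :
    (x • 𝟙 A + y • φ) ≫ (x • 𝟙 A + y • (-φ)) = (x * x + y * y * d) • 𝟙 A + (0 : ℕ) • φ := by
  simp only [smul_neg, Preadditive.add_comp, Preadditive.comp_add, Preadditive.comp_neg, Preadditive.nsmul_comp, Preadditive.comp_nsmul,
    Category.id_comp, Category.comp_id, hφ, zero_smul, add_zero, smul_add, smul_neg, smul_smul, add_smul, mul_comm y x, mul_assoc]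
  abel

/-- `φ` commutes with `x𝟙 + y(−φ)`. [folklore] -/
theorem comp_nsmul_id_add_nsmul_neg_comm (φ : A ⟶ A) (x y : ℕ) :
    φ ≫ (x • 𝟙 A + y • (-φ)) = (x • 𝟙 A + y • (-φ)) ≫ φ := by
  simp only [smul_neg, Preadditive.comp_add, Preadditive.add_comp, Preadditive.comp_neg, Preadditive.neg_comp, Preadditive.comp_nsmul,
    Preadditive.nsmul_comp, Category.id_comp, Category.comp_id]

/-- `(x + iy√d)(x − iy√d) = x² + y²d` in `ℂ`. [folklore] -/
theorem natCast_add_mul_I_mul_sqrt_mul_sub (x y d : ℕ) :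
    ((x : ℂ) + (y : ℂ) * Complex.I * (Real.sqrt d : ℂ)) * ((x : ℂ) - (y : ℂ) * Complex.I * (Real.sqrt d : ℂ)) =
      ((x * x + y * y * d : ℕ) : ℂ) := by
  have hs : ((Real.sqrt d : ℂ)) ^ 2 = (d : ℂ) := by
    rw [← Complex.ofReal_pow, Real.sq_sqrt (Nat.cast_nonneg d), Complex.ofReal_natCast]
  have h : ((x : ℂ) + (y : ℂ) * Complex.I * (Real.sqrt d : ℂ)) * ((x : ℂ) - (y : ℂ) * Complex.I * (Real.sqrt d : ℂ)) =
      (x : ℂ) ^ 2 - (y : ℂ) ^ 2 * Complex.I ^ 2 * (Real.sqrt d : ℂ) ^ 2 := by ring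
  rw [h, Complex.I_sq, hs]
  push_cast
  ring

/-- For `y ≥ 1` and `d ≥ 1`, `x − iy√d ≠ 0` (its product with `x + iy√d` is the positive integer `x² + y²d`). [folklore] -/
theorem natCast_sub_mul_I_mul_sqrt_ne_zero {d : ℕ} (hd : 0 < d) (x : ℕ) {y : ℕ} (hy : y ≠ 0) :
    ((x : ℂ) - (y : ℂ) * Complex.I * (Real.sqrt d : ℂ)) ≠ 0 := by
  intro h
  have hprod := natCast_add_mul_I_mul_sqrt_mul_sub x y d
  rw [h, mul_zero] at hprod
  have hpos : 0 < x * x + y * y * d := by positivity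
  exact absurd hprod.symm (Nat.cast_ne_zero.2 hpos.ne')

/-- For `y ≥ 1` and `d ≥ 1`, `x + iy√d ≠ 0`. [folklore] -/
theorem natCast_add_mul_I_mul_sqrt_ne_zero {d : ℕ} (hd : 0 < d) (x : ℕ) {y : ℕ} (hy : y ≠ 0) :
    ((x : ℂ) + (y : ℂ) * Complex.I * (Real.sqrt d : ℂ)) ≠ 0 := by
  intro h
  have hprod := natCast_add_mul_I_mul_sqrt_mul_sub x y d
  rw [h, zero_mul] at hprod
  have hpos : 0 < x * x + y * y * d := by positivity
  exact absurd hprod.symm (Nat.cast_ne_zero.2 hpos.ne')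

/-- **`E₋(A, φ) ≤ E₊(A, −φ)`**: a joint eigenclass of the `(x𝟙 + yφ)^*` for the character `(x − iy√d)^{2n}` is a joint eigenclass of the
`(x𝟙 − yφ)^*` for `(x + iy√d)^{2n}` — from `(x𝟙 + yφ)^*(x𝟙 − yφ)^* = ((x² + y²d)𝟙)^* = (x² + y²d)^{2n}` on `E₋(A, φ)` and
`(x + iy√d)(x − iy√d) = x² + y²d`. [cite: vanGeemen1994HodgeAV, 4.9 and proof of Lemma 5.2 (6)] -/
theorem weilClassesMinus_le_weilClassesPlus_neg {n d : ℕ} (hd : 0 < d) {φ : A ⟶ A} (hφ : φ ≫ φ = -(d • 𝟙 A)) :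
    weilClassesMinus A φ n d ≤ weilClassesPlus A (-φ) n d := by
  intro c hc
  rw [mem_weilClassesPlus_iff]
  intro x y
  by_cases hy : y = 0
  · subst hy
    have h := (mem_weilClassesMinus_iff.1 hc) x 0
    simp only [Nat.cast_zero, zero_mul, sub_zero, zero_smul, add_zero] at h ⊢
    exact h
  -- `g = x𝟙 + y(−φ)` preserves `E₋(A, φ)`
  have hgc := map_mem_pullbackEigenclasses A φ (comp_nsmul_id_add_nsmul_neg_comm φ x y) hc
  -- `(x𝟙 + yφ)^* (g^* c) = (x − iy√d)^{2n} • g^* c`, and the left side is `((x²+y²d)𝟙)^* c = (x²+y²d)^{2n} • c`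
  have h1 := (mem_pullbackEigenclasses_iff.1 hgc) x y
  rw [abelianVariety_map_map_apply, nsmul_id_add_nsmul_comp_nsmul_id_add_nsmul_neg hφ x y,
    (mem_weilClassesMinus_iff.1 hc) (x * x + y * y * d) 0] at h1
  simp only [Nat.cast_zero, zero_mul, sub_zero] at h1
  -- divide by `(x − iy√d)^{2n}`
  set α : ℂ := (x : ℂ) + (y : ℂ) * Complex.I * (Real.sqrt d : ℂ) with hα
  set β : ℂ := (x : ℂ) - (y : ℂ) * Complex.I * (Real.sqrt d : ℂ) with hβ
  have hαβ : α * β = ((x * x + y * y * d : ℕ) : ℂ) := natCast_add_mul_I_mul_sqrt_mul_sub x y d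
  have hβ0 : β ^ (2 * n) ≠ 0 := pow_ne_zero _ (natCast_sub_mul_I_mul_sqrt_ne_zero hd x hy)
  refine smul_right_injective _ hβ0 ?_
  change β ^ (2 * n) • _ = β ^ (2 * n) • (α ^ (2 * n) • c)
  rw [← h1, smul_smul, ← mul_pow, mul_comm β α, hαβ]

/-- **`E₊(A, φ) ≤ E₋(A, −φ)`** (same identity, the other character). [cite: vanGeemen1994HodgeAV, 4.9 and proof of Lemma 5.2 (6)] -/
theorem weilClassesPlus_le_weilClassesMinus_neg {n d : ℕ} (hd : 0 < d) {φ : A ⟶ A} (hφ : φ ≫ φ = -(d • 𝟙 A)) :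
    weilClassesPlus A φ n d ≤ weilClassesMinus A (-φ) n d := by
  intro c hc
  rw [mem_weilClassesMinus_iff]
  intro x y
  by_cases hy : y = 0
  · subst hy
    have h := (mem_weilClassesPlus_iff.1 hc) x 0
    simp only [Nat.cast_zero, zero_mul, sub_zero, zero_smul, add_zero] at h ⊢
    exact h
  have hgc := map_mem_pullbackEigenclasses A φ (comp_nsmul_id_add_nsmul_neg_comm φ x y) hc
  have h1 := (mem_pullbackEigenclasses_iff.1 hgc) x y
  rw [abelianVariety_map_map_apply, nsmul_id_add_nsmul_comp_nsmul_id_add_nsmul_neg hφ x y,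
    (mem_weilClassesPlus_iff.1 hc) (x * x + y * y * d) 0] at h1
  simp only [Nat.cast_zero, zero_mul, add_zero] at h1
  set α : ℂ := (x : ℂ) + (y : ℂ) * Complex.I * (Real.sqrt d : ℂ) with hα
  set β : ℂ := (x : ℂ) - (y : ℂ) * Complex.I * (Real.sqrt d : ℂ) with hβ
  have hαβ : α * β = ((x * x + y * y * d : ℕ) : ℂ) := natCast_add_mul_I_mul_sqrt_mul_sub x y d
  have hα0 : α ^ (2 * n) ≠ 0 := pow_ne_zero _ (natCast_add_mul_I_mul_sqrt_ne_zero hd x hy)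
  refine smul_right_injective _ hα0 ?_
  change α ^ (2 * n) • _ = α ^ (2 * n) • (β ^ (2 * n) • c)
  rw [← h1, smul_smul, ← mul_pow, hαβ]

/-- **`E₋(A, φ) = E₊(A, −φ)`** for `φ² = −d`, `d ≥ 1`. [cite: vanGeemen1994HodgeAV, 4.9 and proof of Lemma 5.2 (6)] -/
theorem weilClassesMinus_eq_weilClassesPlus_neg {n d : ℕ} (hd : 0 < d) {φ : A ⟶ A} (hφ : φ ≫ φ = -(d • 𝟙 A)) :
    weilClassesMinus A φ n d = weilClassesPlus A (-φ) n d := by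
  refine le_antisymm (weilClassesMinus_le_weilClassesPlus_neg hd hφ) ?_
  have h := weilClassesPlus_le_weilClassesMinus_neg (n := n) hd (neg_comp_neg_eq_neg_nsmul hφ)
  rwa [neg_neg] at h

/-- **`E₊(A, φ) = E₋(A, −φ)`** for `φ² = −d`, `d ≥ 1`. [cite: vanGeemen1994HodgeAV, 4.9 and proof of Lemma 5.2 (6)] -/
theorem weilClassesPlus_eq_weilClassesMinus_neg {n d : ℕ} (hd : 0 < d) {φ : A ⟶ A} (hφ : φ ≫ φ = -(d • 𝟙 A)) :
    weilClassesPlus A φ n d = weilClassesMinus A (-φ) n d := by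
  refine le_antisymm (weilClassesPlus_le_weilClassesMinus_neg hd hφ) ?_
  have h := weilClassesMinus_le_weilClassesPlus_neg (n := n) hd (neg_comp_neg_eq_neg_nsmul hφ)
  rwa [neg_neg] at h

/-- **The Weil plane of the conjugate structure is the same plane**: `E₊(−φ) ⊔ E₋(−φ) = E₊(φ) ⊔ E₋(φ)`.
[cite: vanGeemen1994HodgeAV, 4.9] -/
theorem weilClassesOf_neg {n d : ℕ} (hd : 0 < d) {φ : A ⟶ A} (hφ : φ ≫ φ = -(d • 𝟙 A)) :
    weilClassesOf A (-φ) n d = weilClassesOf A φ n d := by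
  rw [weilClassesOf, weilClassesOf, ← weilClassesMinus_eq_weilClassesPlus_neg hd hφ, ← weilClassesPlus_eq_weilClassesMinus_neg hd hφ,
    sup_comm]

end Conjugate

/-! ## §2 Cross products of non-zero classes are non-zero (any degrees) -/

section CrossNeZero

variable {m n : ℕ} {Y X : SchemeOver ℂ}

/-- **`pr_Y^* a ∪ pr_X^* b ≠ 0` for `a ≠ 0`, `b ≠ 0`** on smooth projective `Y`, `X` (any degrees): as a correspondence `X ⊢ Y` the class acts by
`u ↦ ±λ ⟨u, b⟩_X • a` with `λ ≠ 0` (the tree's `corrAction_sum_cross_apply`, Voisin I (11.11)), and `⟨u, b⟩_X ≠ 0` for some `u` (Poincaré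
duality on `X`). [cite: VoisinHodgeI2002, §11.3.3 Lemma 11.41 (11.11)] [cite: HatcherAT2002, §3.3 Prop. 3.38] -/
theorem cupProduct_map_fst_map_snd_ne_zero_of_ne_zero (hY : IsSmoothProjective m Y) (hX : IsSmoothProjective n X) {b' k e : ℕ}
    (hbk : b' + k = 2 * e) (hk : k ≤ 2 * n) {a : complexBetti Y b'} (ha : a ≠ 0) {b : complexBetti X k} (hb : b ≠ 0) :
    cupProduct hbk (complexBetti.map (fst Y X) b' a) (complexBetti.map (snd Y X) k b) ≠ 0 := by
  -- a class `u` pairing non-trivially with `b`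
  have hka : k + (2 * n - k) = 2 * n := by omega
  have hak : (2 * n - k) + k = 2 * n := by omega
  obtain ⟨u, hu⟩ : ∃ u : complexBetti X (2 * n - k), cupPairing (complexOrientationFamily hX) hak u b ≠ 0 := by
    by_contra! hall
    refine hb (eq_zero_of_forall_cupPairing_eq_zero complexOrientationFamily hX hka fun u ↦ ?_)
    rw [cupPairing_apply, cupProduct_gradedComm_holds ℂ _ hka hak b u, map_smul, LinearMap.smul_apply, ← cupPairing_apply, hall u, smul_zero]
  obtain ⟨ω₁, lam, hlam0, hω₁, hlam⟩ := exists_complexGysin_fst_map_snd_eq_smul_one complexOrientationFamily hY hX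
  intro h0
  -- the linear map `v ↦ (⟨v, b⟩ / ⟨u, b⟩) • a`, taking `u` to `a`
  set φ : complexBetti X (2 * n - k) →ₗ[ℂ] complexBetti Y b' :=
    LinearMap.smulRight ((cupPairing (complexOrientationFamily hX) hak u b)⁻¹ • (cupPairing (complexOrientationFamily hX) hak).flip b) a with hφ
  have hφu : φ u = a := by
    simp only [hφ, LinearMap.smulRight_apply, LinearMap.smul_apply, LinearMap.flip_apply, smul_eq_mul, inv_mul_cancel₀ hu, one_smul]
  -- the action of the cross product on `u`
  have hab : (2 * n - k) + 2 * e = b' + 2 * n := by omega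
  have hact := corrAction_sum_cross_apply complexOrientationFamily hY hX hab hak hbk φ (ι := Unit) (fun _ ↦ u) (fun _ ↦ b) hω₁ hlam u
  simp only [Finset.univ_unique, Finset.sum_singleton, hφu] at hact
  rw [h0, map_zero, LinearMap.zero_apply] at hact
  have hne : ((-1 : ℂ) ^ ((2 * n - k) * b') * lam) • cupPairing (complexOrientationFamily hX) hak u b • a ≠ 0 :=
    smul_ne_zero (mul_ne_zero (pow_ne_zero _ (neg_ne_zero.2 one_ne_zero)) hlam0) (smul_ne_zero hu ha)
  exact hne hact.symm

end CrossNeZero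

/-! ## §3 The twisted product `(A₁ × A₂, φ₁ × (−φ₂))` -/

section Twisted

variable {A₁ A₂ : Motives.AbelianVariety ℂ}

/-- **The twisted product endomorphism `φ₁ × (−φ₂)`** of `A₁ × A₂` (display abbreviation through `prodLift`; NOT a definition of the tree).
[cite: Schoen1998HodgeWeilAddendum, §10 (proof of the Proposition)] -/
local notation3 (prettyPrint := false) "twistedProd[" φ₁ ", " φ₂ "]" =>
  Motives.AbelianVariety.prodLift (Motives.AbelianVariety.fst _ _ ≫ φ₁) (Motives.AbelianVariety.snd _ _ ≫ (-φ₂))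

/-- `(φ₁ × (−φ₂)) ≫ pr₁ = pr₁ ≫ φ₁`. [folklore] -/
theorem twistedProd_comp_fst (φ₁ : A₁ ⟶ A₁) (φ₂ : A₂ ⟶ A₂) :
    twistedProd[φ₁, φ₂] ≫ Motives.AbelianVariety.fst A₁ A₂ = Motives.AbelianVariety.fst A₁ A₂ ≫ φ₁ := Motives.AbelianVariety.prodLift_fst _ _
/-- `(φ₁ × (−φ₂)) ≫ pr₂ = pr₂ ≫ (−φ₂)`. [folklore] -/
theorem twistedProd_comp_snd (φ₁ : A₁ ⟶ A₁) (φ₂ : A₂ ⟶ A₂) :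
    twistedProd[φ₁, φ₂] ≫ Motives.AbelianVariety.snd A₁ A₂ = Motives.AbelianVariety.snd A₁ A₂ ≫ (-φ₂) := Motives.AbelianVariety.prodLift_snd _ _

/-- **`(φ₁ × (−φ₂))² = −d`**: the twisted product of two `K`-structures is a `K`-structure on `A₁ × A₂`.
[cite: Schoen1998HodgeWeilAddendum, §10 (proof of the Proposition)] [cite: Markman2025SurveySecant, §11.5 Step 2] -/
theorem twistedProd_comp_self_eq_neg_nsmul {d : ℕ} {φ₁ : A₁ ⟶ A₁} {φ₂ : A₂ ⟶ A₂} (hφ₁ : φ₁ ≫ φ₁ = -(d • 𝟙 A₁))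
    (hφ₂ : φ₂ ≫ φ₂ = -(d • 𝟙 A₂)) : twistedProd[φ₁, φ₂] ≫ twistedProd[φ₁, φ₂] = -(d • 𝟙 (A₁.prod A₂)) :=
  prod_comp_self_eq_neg_nsmul hφ₁ (neg_comp_neg_eq_neg_nsmul hφ₂) (twistedProd_comp_fst φ₁ φ₂) (twistedProd_comp_snd φ₁ φ₂)

variable {d : ℕ} {φ₁ : A₁ ⟶ A₁} {φ₂ : A₂ ⟶ A₂} {Φ : A₁.prod A₂ ⟶ A₁.prod A₂}
  (h₁ : Φ ≫ Motives.AbelianVariety.fst A₁ A₂ = Motives.AbelianVariety.fst A₁ A₂ ≫ φ₁)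
  (h₂ : Φ ≫ Motives.AbelianVariety.snd A₁ A₂ = Motives.AbelianVariety.snd A₁ A₂ ≫ (-φ₂))
  (hd : 0 < d) (hφ₂ : φ₂ ≫ φ₂ = -(d • 𝟙 A₂))

include h₁ h₂ hd hφ₂

/-- **`E₊(A₁, φ₁) ⊠ E₋(A₂, φ₂) ⊆ E₊(A₁ × A₂, Φ)`** for `Φ` compatible with `φ₁` and `−φ₂` (the twisted product): `E₋(A₂, φ₂) = E₊(A₂, −φ₂)` (§1)
and exterior products of `E₊`-classes are `E₊`-classes (`HodgeTheory/WeilClassesFourfoldsProofs`).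
[cite: Schoen1998HodgeWeilAddendum, §10 (proof of the Proposition)] [cite: vanGeemen1994HodgeAV, proof of Thm. 6.12] -/
theorem cupProduct_map_fst_map_snd_mem_weilClassesPlus_of_plus_of_minus {n₁ n₂ : ℕ} {c₁ : complexBetti A₁.X (2 * n₁)}
    {c₂ : complexBetti A₂.X (2 * n₂)} (hc₁ : c₁ ∈ weilClassesPlus A₁ φ₁ n₁ d) (hc₂ : c₂ ∈ weilClassesMinus A₂ φ₂ n₂ d) :
    cupProduct (two_mul_add_two_mul n₁ n₂) (complexBetti.map (Motives.AbelianVariety.fst A₁ A₂).hom.hom.hom (2 * n₁) c₁)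
        (complexBetti.map (Motives.AbelianVariety.snd A₁ A₂).hom.hom.hom (2 * n₂) c₂) ∈
      weilClassesPlus (A₁.prod A₂) Φ (n₁ + n₂) d :=
  cupProduct_map_fst_map_snd_mem_weilClassesPlus h₁ h₂ hc₁ (weilClassesMinus_le_weilClassesPlus_neg hd hφ₂ hc₂)

/-- **`E₋(A₁, φ₁) ⊠ E₊(A₂, φ₂) ⊆ E₋(A₁ × A₂, Φ)`** for the twisted product. [cite: Schoen1998HodgeWeilAddendum, §10 (proof of the Proposition)]
[cite: vanGeemen1994HodgeAV, proof of Thm. 6.12] -/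
theorem cupProduct_map_fst_map_snd_mem_weilClassesMinus_of_minus_of_plus {n₁ n₂ : ℕ} {c₁ : complexBetti A₁.X (2 * n₁)}
    {c₂ : complexBetti A₂.X (2 * n₂)} (hc₁ : c₁ ∈ weilClassesMinus A₁ φ₁ n₁ d) (hc₂ : c₂ ∈ weilClassesPlus A₂ φ₂ n₂ d) :
    cupProduct (two_mul_add_two_mul n₁ n₂) (complexBetti.map (Motives.AbelianVariety.fst A₁ A₂).hom.hom.hom (2 * n₁) c₁)
        (complexBetti.map (Motives.AbelianVariety.snd A₁ A₂).hom.hom.hom (2 * n₂) c₂) ∈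
      weilClassesMinus (A₁.prod A₂) Φ (n₁ + n₂) d :=
  cupProduct_map_fst_map_snd_mem_weilClassesMinus h₁ h₂ hc₁ (weilClassesPlus_le_weilClassesMinus_neg hd hφ₂ hc₂)

/-- **THE MIXED WEIL COMPONENT LIES IN THE WEIL PLANE OF THE TWISTED PRODUCT**: for `u₊ ∈ E₊(A₁)`, `u₋ ∈ E₋(A₁)`, `v₊ ∈ E₊(A₂)`, `v₋ ∈ E₋(A₂)`,
`pr₁^* u₊ ∪ pr₂^* v₋ + pr₁^* u₋ ∪ pr₂^* v₊ ∈ E₊(A₁ × A₂, Φ) ⊔ E₋(A₁ × A₂, Φ)`. These are exactly the two exterior products that lie OUTSIDE the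
Weil plane of the untwisted product `φ₁ × φ₂` (`HodgeTheory/WeilClassesProducts`, module docstring).
[cite: Schoen1998HodgeWeilAddendum, §10 (proof of the Proposition)] [cite: Deligne1982HodgeCycles, §4 (4.3)–(4.4)] -/
theorem mixedWeilComponent_mem_weilClassesOf {n₁ n₂ : ℕ} {up um : complexBetti A₁.X (2 * n₁)} {vp vm : complexBetti A₂.X (2 * n₂)}
    (hup : up ∈ weilClassesPlus A₁ φ₁ n₁ d) (hum : um ∈ weilClassesMinus A₁ φ₁ n₁ d) (hvp : vp ∈ weilClassesPlus A₂ φ₂ n₂ d)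
    (hvm : vm ∈ weilClassesMinus A₂ φ₂ n₂ d) :
    cupProduct (two_mul_add_two_mul n₁ n₂) (complexBetti.map (Motives.AbelianVariety.fst A₁ A₂).hom.hom.hom (2 * n₁) up)
        (complexBetti.map (Motives.AbelianVariety.snd A₁ A₂).hom.hom.hom (2 * n₂) vm) +
      cupProduct (two_mul_add_two_mul n₁ n₂) (complexBetti.map (Motives.AbelianVariety.fst A₁ A₂).hom.hom.hom (2 * n₁) um)
        (complexBetti.map (Motives.AbelianVariety.snd A₁ A₂).hom.hom.hom (2 * n₂) vp) ∈
      weilClassesOf (A₁.prod A₂) Φ (n₁ + n₂) d :=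
  Submodule.add_mem _ (weilClassesPlus_le_weilClassesOf _ _ _ _ (cupProduct_map_fst_map_snd_mem_weilClassesPlus_of_plus_of_minus h₁ h₂ hd hφ₂ hup hvm))
    (weilClassesMinus_le_weilClassesOf _ _ _ _ (cupProduct_map_fst_map_snd_mem_weilClassesMinus_of_minus_of_plus h₁ h₂ hd hφ₂ hum hvp))

end Twisted

/-! ## §4 Algebraicity bookkeeping: eigen-components, and the Weil plane from one mixed class -/

section Algebraic

variable {B : Motives.AbelianVariety ℂ}

/-- There is a test value `x ∈ ℕ` separating the two Weil characters: `(x + i√d)^{2n} ≠ (x − i√d)^{2n}` (`n, d ≥ 1`; the tree's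
`eq_zero_of_forall_natCast_add_pow_eq`). [cite: vanGeemen1994HodgeAV, proof of Thm. 6.12] -/
theorem exists_natCast_add_pow_ne_sub_pow {n d : ℕ} (hn : 0 < n) (hd : 0 < d) :
    ∃ x : ℕ, ((x : ℂ) + Complex.I * (Real.sqrt d : ℂ)) ^ (2 * n) ≠ ((x : ℂ) - Complex.I * (Real.sqrt d : ℂ)) ^ (2 * n) := by
  by_contra! hall
  have h0 := eq_zero_of_forall_natCast_add_pow_eq (m := 2 * n) (by omega) hall
  exact I_mul_sqrt_ne_zero hd h0

/-- **EIGEN-COMPONENTS OF AN ALGEBRAIC CLASS ARE ALGEBRAIC**: on an abelian variety `B` with `ψ ≫ ψ = −d` (`n, d ≥ 1`), if `c₊ ∈ E₊(B, ψ)`,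
`c₋ ∈ E₋(B, ψ)` and `c₊ + c₋ ∈ Nⁿ(B)`, then `c₊, c₋ ∈ Nⁿ(B)`: pull back by one test endomorphism `x𝟙 + ψ` with `(x + i√d)^{2n} ≠ (x − i√d)^{2n}`
(pull-back along an endomorphism of an abelian variety preserves algebraic classes — the tree's PROVED `map_mem_algebraicClasses_of_abelianVariety`,
Fulton Cor. 19.2 (b) via Kleiman's moving by translates) and solve the `2 × 2` system. [cite: Fulton1998, §19.2 Cor. 19.2 (b)]
[cite: vanGeemen1994HodgeAV, proof of Thm. 6.12] -/
theorem mem_algebraicClasses_of_add_mem_algebraicClasses {n d : ℕ} (hn : 0 < n) (hd : 0 < d) {ψ : B ⟶ B}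
    {cp cm : complexBetti B.X (2 * n)} (hcp : cp ∈ weilClassesPlus B ψ n d) (hcm : cm ∈ weilClassesMinus B ψ n d)
    (halg : cp + cm ∈ algebraicClasses B.X n) : cp ∈ algebraicClasses B.X n ∧ cm ∈ algebraicClasses B.X n := by
  obtain ⟨x, hx⟩ := exists_natCast_add_pow_ne_sub_pow hn hd
  have hB : IsSmoothProjective B.dim B.X := Motives.AbelianVariety.isSmoothProjective_holds
  -- pull back by the test endomorphism `x𝟙 + 1ψ`
  have hmap : complexBetti.map (x • 𝟙 B + (1 : ℕ) • ψ).hom.hom.hom (2 * n) (cp + cm) ∈ algebraicClasses B.X n :=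
    map_mem_algebraicClasses_of_abelianVariety hB B _ halg
  have ep := (mem_weilClassesPlus_iff.1 hcp) x 1
  have em := (mem_weilClassesMinus_iff.1 hcm) x 1
  simp only [Nat.cast_one, one_mul] at ep em
  rw [map_add] at hmap
  erw [ep, em] at hmap
  have h1 : (1 : ℂ) • cp + (1 : ℂ) • cm ∈ algebraicClasses B.X n := by rwa [one_smul, one_smul]
  have h2 : (((x : ℂ) + Complex.I * (Real.sqrt d : ℂ)) ^ (2 * n) * 1) • cp + (((x : ℂ) - Complex.I * (Real.sqrt d : ℂ)) ^ (2 * n) * 1) • cm ∈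
      algebraicClasses B.X n := by rwa [mul_one, mul_one]
  exact mem_and_mem_of_smul_add_smul_mem (algebraicClasses B.X n) hx one_ne_zero one_ne_zero h1 h2

/-- **THE WEIL PLANE FROM ONE CLASS WITH A NON-ZERO `E₊`-COMPONENT**: on an abelian `2n`-fold `B` with `ψ ≫ ψ = −d` (`n, d ≥ 1`), if `c₊ ∈ E₊`,
`c₋ ∈ E₋`, `c₊ ≠ 0` and `c₊ + c₋` is algebraic, then EVERY class of the Weil plane `E₊ ⊔ E₋` of `(B, ψ)` is algebraic (`E±` are lines —
`H•(B(ℂ)) = ⋀•H¹` and `b₁ = 4n` are THEOREMS of the tree — and complex conjugation swaps them).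
[cite: vanGeemen1994HodgeAV, 4.9 and proof of Thm. 6.12] [cite: Schoen1988HodgeWeil, §1 Lemma 1.2] -/
theorem weilClassesOf_le_algebraicClasses_of_add_mem {n d : ℕ} (hn : 0 < n) (hd : 0 < d) (hB : B.dim = 2 * n) {ψ : B ⟶ B}
    (hψ : ψ ≫ ψ = -(d • 𝟙 B)) {cp cm : complexBetti B.X (2 * n)} (hcp : cp ∈ weilClassesPlus B ψ n d) (hcm : cm ∈ weilClassesMinus B ψ n d)
    (h0 : cp ≠ 0) (halg : cp + cm ∈ algebraicClasses B.X n) : weilClassesOf B ψ n d ≤ algebraicClasses B.X n := by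
  have hb₁ : Module.finrank ℂ (complexBetti B.X 1) = 2 * (2 * n) := by rw [Motives.AbelianVariety.finrank_complexBetti_one, hB]
  exact weilClassesOf_le_algebraicClasses_of_exists_mem_weilClassesPlus (Motives.AbelianVariety.hasExteriorCohomologyH1_complexPoints B) hb₁ hd hψ
    ⟨cp, hcp, (mem_algebraicClasses_of_add_mem_algebraicClasses hn hd hcp hcm halg).1, h0⟩

variable {A₁ A₂ : Motives.AbelianVariety ℂ} {d : ℕ} {φ₁ : A₁ ⟶ A₁} {φ₂ : A₂ ⟶ A₂} {Φ : A₁.prod A₂ ⟶ A₁.prod A₂}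
  (h₁ : Φ ≫ Motives.AbelianVariety.fst A₁ A₂ = Motives.AbelianVariety.fst A₁ A₂ ≫ φ₁)
  (h₂ : Φ ≫ Motives.AbelianVariety.snd A₁ A₂ = Motives.AbelianVariety.snd A₁ A₂ ≫ (-φ₂))
  (hd : 0 < d) (hφ₁ : φ₁ ≫ φ₁ = -(d • 𝟙 A₁)) (hφ₂ : φ₂ ≫ φ₂ = -(d • 𝟙 A₂))

include h₁ h₂ hd hφ₂

/-- **ONE ALGEBRAIC MIXED CLASS MAKES THE WEIL PLANE OF THE TWISTED PRODUCT ALGEBRAIC.** Let `A₁`, `A₂` be abelian varieties of dimensions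
`2n₁`, `2n₂` with `φᵢ ≫ φᵢ = −d` (`d ≥ 1`, `n₁ + n₂ ≥ 1`), `Φ` an endomorphism of `A₁ × A₂` compatible with `φ₁` and `−φ₂`. If `u₊ ∈ E₊(A₁)`,
`u₋ ∈ E₋(A₁)`, `v₊ ∈ E₊(A₂)`, `v₋ ∈ E₋(A₂)` with `u₊ ≠ 0 ≠ v₋` and the mixed class `pr₁^*u₊ ∪ pr₂^*v₋ + pr₁^*u₋ ∪ pr₂^*v₊` is ALGEBRAIC on `A₁ × A₂`,
then every class of the Weil plane of `(A₁ × A₂, Φ)` is algebraic. [cite: Schoen1998HodgeWeilAddendum, §10 (proof of the Proposition)]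
[cite: vanGeemen1994HodgeAV, proof of Thm. 6.12] [cite: Fulton1998, §19.2 Cor. 19.2 (b)] -/
theorem weilClassesOf_twistedProd_le_algebraicClasses_of_mixed_mem (hφ₁ : φ₁ ≫ φ₁ = -(d • 𝟙 A₁)) {n₁ n₂ : ℕ} (hn : 0 < n₁ + n₂)
    (hA₁ : A₁.dim = 2 * n₁) (hA₂ : A₂.dim = 2 * n₂)
    {up um : complexBetti A₁.X (2 * n₁)} {vp vm : complexBetti A₂.X (2 * n₂)}
    (hup : up ∈ weilClassesPlus A₁ φ₁ n₁ d) (hum : um ∈ weilClassesMinus A₁ φ₁ n₁ d) (hvp : vp ∈ weilClassesPlus A₂ φ₂ n₂ d)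
    (hvm : vm ∈ weilClassesMinus A₂ φ₂ n₂ d) (hu0 : up ≠ 0) (hv0 : vm ≠ 0)
    (halg : cupProduct (two_mul_add_two_mul n₁ n₂) (complexBetti.map (Motives.AbelianVariety.fst A₁ A₂).hom.hom.hom (2 * n₁) up)
        (complexBetti.map (Motives.AbelianVariety.snd A₁ A₂).hom.hom.hom (2 * n₂) vm) +
      cupProduct (two_mul_add_two_mul n₁ n₂) (complexBetti.map (Motives.AbelianVariety.fst A₁ A₂).hom.hom.hom (2 * n₁) um)
        (complexBetti.map (Motives.AbelianVariety.snd A₁ A₂).hom.hom.hom (2 * n₂) vp) ∈ algebraicClasses (A₁.prod A₂).X (n₁ + n₂)) :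
    weilClassesOf (A₁.prod A₂) Φ (n₁ + n₂) d ≤ algebraicClasses (A₁.prod A₂).X (n₁ + n₂) := by
  have hne : cupProduct (two_mul_add_two_mul n₁ n₂) (complexBetti.map (Motives.AbelianVariety.fst A₁ A₂).hom.hom.hom (2 * n₁) up)
      (complexBetti.map (Motives.AbelianVariety.snd A₁ A₂).hom.hom.hom (2 * n₂) vm) ≠ 0 :=
    cupProduct_map_fst_map_snd_ne_zero_of_ne_zero (Motives.AbelianVariety.isSmoothProjective_holds (A := A₁))
      (Motives.AbelianVariety.isSmoothProjective_holds (A := A₂)) (two_mul_add_two_mul n₁ n₂) (by rw [hA₂]; omega) hu0 hv0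
  exact weilClassesOf_le_algebraicClasses_of_add_mem hn hd (dim_prod_eq_two_mul hA₁ hA₂) (prod_comp_self_eq_neg_nsmul hφ₁ (neg_comp_neg_eq_neg_nsmul hφ₂) h₁ h₂)
    (cupProduct_map_fst_map_snd_mem_weilClassesPlus_of_plus_of_minus h₁ h₂ hd hφ₂ hup hvm)
    (cupProduct_map_fst_map_snd_mem_weilClassesMinus_of_minus_of_plus h₁ h₂ hd hφ₂ hum hvp) hne halg

omit hφ₂ in
/-- **Conversely**: if every class of the Weil plane of the twisted product is algebraic, so is every mixed class (membership, §3).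
[cite: Schoen1998HodgeWeilAddendum, §10 (proof of the Proposition)] -/
theorem mixed_mem_algebraicClasses_of_weilClassesOf_le (hφ₂ : φ₂ ≫ φ₂ = -(d • 𝟙 A₂)) {n₁ n₂ : ℕ}
    (hW : weilClassesOf (A₁.prod A₂) Φ (n₁ + n₂) d ≤ algebraicClasses (A₁.prod A₂).X (n₁ + n₂))
    {up um : complexBetti A₁.X (2 * n₁)} {vp vm : complexBetti A₂.X (2 * n₂)}
    (hup : up ∈ weilClassesPlus A₁ φ₁ n₁ d) (hum : um ∈ weilClassesMinus A₁ φ₁ n₁ d) (hvp : vp ∈ weilClassesPlus A₂ φ₂ n₂ d)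
    (hvm : vm ∈ weilClassesMinus A₂ φ₂ n₂ d) :
    cupProduct (two_mul_add_two_mul n₁ n₂) (complexBetti.map (Motives.AbelianVariety.fst A₁ A₂).hom.hom.hom (2 * n₁) up)
        (complexBetti.map (Motives.AbelianVariety.snd A₁ A₂).hom.hom.hom (2 * n₂) vm) +
      cupProduct (two_mul_add_two_mul n₁ n₂) (complexBetti.map (Motives.AbelianVariety.fst A₁ A₂).hom.hom.hom (2 * n₁) um)
        (complexBetti.map (Motives.AbelianVariety.snd A₁ A₂).hom.hom.hom (2 * n₂) vp) ∈ algebraicClasses (A₁.prod A₂).X (n₁ + n₂) :=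
  hW (mixedWeilComponent_mem_weilClassesOf h₁ h₂ hd hφ₂ hup hum hvp hvm)

end Algebraic

end Summit.HodgeConjecture.HodgeConjecture.Ring2.AbelianAll

end
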